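import Mathlib
import Literature.MathematicalPhysics.QuantumFieldTheory.Balaban1983to89.B9Eq395Hom

/-!
# `Balaban1983to89.B9Eq319Avg` — the block-averaging operator Q′ of B9 (3.18)–(3.19) and the block-injection shape of
its adjoint Q′\* in the ℝ-scalar model: block-locality, the weighted-adjoint identity, the (3.24) quadratic form, the
(3.19) normalisation, and the BLOCK-DIAGONAL TWO-SPACE MAJORANTS — the per-operator inputs `hQ` / `hQs` of
`B9Eq395Hom` (b09-g6, p180468) and of `B9Eq395Small.regroup_412` (b09-g6, p180278) SUPPLIED from a typed operator

B9 = T. Bałaban, *Propagators for lattice gauge theories in a background field*, Commun. Math. Phys. **99**, 389–434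
(1985) [Balaban1985BackgroundPropagators] (journal page = PDF page + 388).  [4] = B6 = T. Bałaban, *Propagators and
renormalization transformations for lattice gauge theories. II*, Commun. Math. Phys. **96**, 223–250 (1984)
[Balaban1984PropagatorsII] (journal page = PDF page + 222).  Every quotation below was read from the x2 page renders
`b2b-balaban-ref1/pages/1985-cmp99-background-propagators/…-p005-x2.png` (p. 393) and `…-p006-x2.png` (p. 394), not
from an OCR layer.  No existing module is modified; this module imports `…B9Eq395Hom` (hence `…B9Eq395Small`,
`…B6RandomWalkHom`, pv08's `…B6RandomWalk`) and touches nothing else.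

CITATION HEADER (lean-in-tree rule 2026-08-18).  WHAT IS PRINTED (verbatim).
* B9 p. 393 [PDF 5], (3.15): *"We are interested in the linear operators Q_j(U). They are compositions of j one-step
  averaging operators Q_j(U) = Q(Ū^{j−1})·…·Q(Ū)Q(U), (3.15) where Q(V) is given by the explicit formula (124) in
  [5]."*
* B9 p. 393 [PDF 5], (3.18)–(3.19): *"where Q′λ is defined on 𝔅 = ⋃_{j=0}^{k} Λ_j by the formulas
  (Q′λ)(y) = (Q′_j(U)λ)(y) for y∈Λ_j, (3.18)  (Q′(V)λ)(y) = Σ_{x∈B(y)} L^{−d}R(V(Γ_{y,x}))λ(x),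
  (Q′_j(U)λ)(y) = (Q′(Ū^{j−1})·…·Q′(Ū)Q′(U)λ)(y) = Σ_{x∈B^j(y)} L^{−jd}R(U(Γ^{(j)}_{y,x}))λ(x),  y∈T^{(j)}_{L^jη}. (3.19)
  The contours Γ^{(j)}_{y,x}, x∈B^j(y), and the contour variables U(Γ^{(j)}_{y,x}) were defined by (52), (53) in [5].
  The norm ‖·‖ in (3.17) is determined by the scalar product ⟨λ, λ′⟩ = Σ_{x∈Ω₀} η^d tr λ(x)λ′(x) in the Hilbert space
  L²(Ω₀, 𝔤)."*  (p. 393 also: *"we define Λ_j = Ω_j^{(j)}∖Ω_{j+1}^{(j)}, j = 0,1,…,k, Ω_{k+1} = ∅, or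
  Ω_j∖Ω_{j+1} = B^j(Λ_j), hence Λ_j ⊂ T^{(j)}_{L^jη}."*)
* B9 p. 394 [PDF 6], (3.24): *"Let us introduce the operator Δ′_a = Δ′_a(U) = (Δ^η_U + Q′\*aQ′)↾_{Ω₀}, where Q′\*aQ′ is
  defined by the same quadratic form as in (2.14), i.e. ⟨λ, Q′\*aQ′λ⟩ = Σ_{j=0}^{k} a_j Σ_{y∈Λ_j} (L^jη)^{d−2}
  |(Q′_j(U)λ)(y)|², (3.24) the numbers a_j satisfy the recursive equations a_{j+1} = aa_j/(aL^{−2} + a_j),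
  a₁ = a₀ = a > 0."*
* B9 p. 394 [PDF 6], (3.25): *"Using the Lagrange multipliers method the minimum of (3.22) can be found by the same
  calculations as in [4], (2.15)–(2.17), and we obtain the formula Rf = (I − G′Q′\*(Q′G′²Q′\*)^{−1}Q′G′)f, (3.25) where
  G′ = G′(U) = (Δ′_a)^{−1}."*  (p. 394: *"where R = R(U) is an orthogonal projection in the Hilbert space L²(Ω₀, 𝔤)"*.)
* [4] p. 232 [PDF 10], (2.51)–(2.55), typed by pv08 (`B6RandomWalk.HasMajorant`, `hasMajorant_mul`) and pv21-g2
  (`B6RandomWalkHom.HasMajorantHom`, `hasMajorantHom_comp`): *"this property is preserved under the composition of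
  operators possessing it. A summation preserves it also."*

THE READING (typed objects; every choice is recorded in the cell's DIVERGENCE D-b09.17).
(a) ℝ-SCALAR MODEL (as in every b09 kernel module, D-b09.12): the rotation R(U(Γ^{(j)}_{y,x})) acting isometrically
    on 𝔤 is replaced by a real number r(x), the functions λ are real-valued; the majorant calculus only ever uses
    |R| ≤ 1.  The blocks B^j(y), y ∈ Λ_j, j = 0,…,k, PARTITION Ω₀ (p. 393: Ω_j∖Ω_{j+1} = B^j(Λ_j), Ω_{k+1} = ∅), so
    the fine lattice X carries ONE block map `blk : X → 𝔅` (pv08's `blk`, x ↦ the y with x ∈ B^j(y)) and Q′ of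
    (3.18)–(3.19) is ONE weighted block sum `avgOp blk w`, (Q′λ)(y) = Σ_{x : blk x = y} w(x)λ(x), with the printed
    weight w(x) = L^{−jd}r(x) for x ∈ B^j(y), y ∈ Λ_j — kept as a free weight function `w : X → ℝ`.
(b) Q′\* is typed by its SHAPE `injOp blk ws`, (Q′\*u)(x) = ws(x)·u(blk x): the adjoint of a weighted block sum with
    respect to ANY pair of weighted ℓ² pairings — Σ_x m(x)λ(x)λ′(x) on the fine lattice (print: m = η^d, p. 393) and
    Σ_y n(y)u(y)u′(y) on 𝔅 (print: the weights of (3.24) are a_j(L^jη)^{d−2}; the pairing behind the Q′\* of (3.25) is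
    by reference to [4] (2.15)–(2.17)) — IS this block injection with ws(x) = n(blk x)w(x)/m(x).  This is PROVED here
    (`avgOp_adjoint`), so the shape of Q′\* is not a reading; only the weights m, n (hence ws) are parameters.
(c) The hypotheses downstream modules placed on Q′, Q′\* are DISCHARGED for these operators: the block-locality inputs
    `hQ`/`hQs` of `B9Eq395Small.chi_comp_mulOp_eq_of_local` / `mulOp_comp_eq_of_local` (hence h1/h2 of `regroup_412`,
    the p. 412 regrouping) and the block-diagonal two-space majorants `hQ`/`hQs` of `B9Eq395Hom.sandwich_majorant` /
    `lloc_majorant` / `commFactor_hA` / `p412_commTerm_majorant`, with c_Q = a bound for the block row sums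
    Σ_{x∈B(y)}|w(x)| and c_{Q\*} = sup|ws|.  For the printed weights, |w(x)|·#B^j(y) = L^{−jd}|r(x)|·L^{jd} ≤ 1 gives
    c_Q = 1 (`fiber_abs_sum_le`: the (3.19) normalisation as the hypothesis |w x|·#(fibre of x) ≤ c_Q).

WHAT IS PROVED (kernel-checked; every constant explicit).
* §1 `injOp`, `injOp_apply`, `injOp_local` ((Q′\*u)(x) = 0 when u(blk x) = 0 — the `hQs` of `mulOp_comp_eq_of_local`);
  `avgOp`, `avgOp_apply`, `avgOp_local` ((Q′λ)(y) depends on λ↾B(y) only — the `hQ` of `chi_comp_mulOp_eq_of_local`).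
* §2 `avgOp_adjoint` (Σ_y n(y)u(y)(Q′λ)(y) = Σ_x m(x)(Q′\*u)(x)λ(x) with ws = n(blk x)w(x)/m(x), m ≠ 0),
  `quadForm_324` (Σ_x m(x)λ(x)(Q′\*Q′λ)(x) = Σ_y n(y)((Q′λ)(y))² — the shape of (3.24) with n(y) = a_j(L^jη)^{d−2}),
  `fiber_abs_sum_le` (|w(x)|·#{x′ : blk x′ = blk x} ≤ c_Q for all x ⇒ Σ_{x : blk x = y}|w(x)| ≤ c_Q for all y).
* §3 (any `B6.Geometry`, [4] (2.51) two-space shape of pv21): `avgOp_hasMajorantHom` (row sums ≤ c_Q ⇒ Q′ has the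
  two-space majorant c_Q·1_{y=y′} from the fine lattice (block map `blk`) to 𝔅 (block map id); `avgOp_hasMajorantHom_card`:
  the same from |w(x)|·#B(y(x)) ≤ c_Q), `injOp_hasMajorantHom` (|ws| ≤ c_{Q\*} ⇒ Q′\* has the majorant c_{Q\*}·1_{y=y′}
  from 𝔅 to the fine lattice).
* §4 (the B9 geometry of `B9Thm34Ext.toB6`, the exact hypothesis shapes of `B9Eq395Hom`): `avgOp_hasMajorantHom_b9`,
  `injOp_hasMajorantHom_b9`; `regroup_h1_avg` / `regroup_h2_avg` (h1: □̃Q′h′ = □̃Q′ and h2: h′Q′\*h_□ = Q′\*h_□ of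
  `regroup_412` for Q′ = `avgOp`, Q′\* = `injOp`, from h′ = 1 on the blocks of S_χ ⊇ the sites where □̃ ≠ 0 /
  h_□ ≠ 0); `sandwich_majorant_avg`, `lloc_majorant_avg` (L_□ = Q′G′_□G′_□Q′\* ≺ κ_L(P y)⁻¹e^{−ρδ₀d},
  κ_L = c_Qc_{Q\*}B_G²C·c₁(δ₀, a_G−ρ)), `commFactor_hA_avg` (A = Q′[G′_{□₀}, h′²]G′_{□₀}Q′\* ≺ θ_A(P y)⁻¹e^{−ρδ₀d},
  θ_A = c_Qc_{Q\*}(2ℓ₀ + 2ℓ₁(α_cδ₀)⁻¹)B_G²C·c₁(δ₀, a_G−ρ)), `p412_commTerm_majorant_avg` (the first p. 412 term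
  □̃·A·h_□C_□h_□ ≺ 1_{S_□}(y′)θ_AB₀C′c₁(δ₀, b−ρ′)e^{−ρ′δ₀d}) — gen 6's theorems with hQ/hQs no longer hypotheses.

WHAT IS NOT REPRODUCED (NAMED hypotheses of printed shape / not modelled; cell rows GAPS C-B9-26, G-B9-24 as amended).
(i) The 𝔤-valued / group structure: R(U(Γ)) ∈ a compact group acting isometrically, tr in the scalar product, the
    contours of [5] (52)–(53) — replaced by the scalar weight r(x) with |r| ≤ 1 inside w; (ii) the specific weights
    (w = L^{−jd}r, m = η^d, n = a_j(L^jη)^{d−2}) are parameters — in particular the pairing that defines the Q′\* of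
    (3.25) is by reference to [4] (2.15)–(2.17) and is not fixed here, so c_{Q\*} stays a parameter; (iii) #B^j(y) =
    L^{jd} (the block geometry of [4] (2.1)–(2.4)) enters only through the hypothesis of `fiber_abs_sum_le`; (iv) nothing
    about G′, (3.42), (3.48), [2], the partitions of unity or the 𝒟′ combinatorics is asserted — the remaining
    hypotheses hG, hCl, hLip, hST, h261, hPP, htri/hsymm/hdnn of `B9Eq395Hom` are carried unchanged.

Unit: b2b-balaban-b09-g6 (PAPER SUB-CELL B09, gen 6), journal claim SHARPEN T06.9 pass 5 ∕ C-B9-25-AVG-OPS; cell rows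
GAPS C-B9-26, DIVERGENCE D-b09.17.  Value = kernel-checked bookkeeping (two named hypotheses of gen 6 discharged from a
typed operator of the printed shape), NOT summit progress.
-/

namespace Literature.MathematicalPhysics.QuantumFieldTheory.Balaban1983to89.B9Eq319Avg

open Literature.MathematicalPhysics.QuantumFieldTheory.Balaban1983to89
open Finset B9Thm37Sum

/-! ## §1  The operators: block injection (shape of Q′\*) and block averaging (shape of (3.19)) -/

section InjOp

variable {X S : Type}

/-- The BLOCK-INJECTION shape of Q′\* (reading (b) of the header): (Q′\*u)(x) = ws(x)·u(y(x)) — the value of u at the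
block containing x, weighted.  [cite: Balaban1985BackgroundPropagators, (3.25) p.394] -/
def injOp (blk : X → S) (ws : X → ℝ) : (S → ℝ) →ₗ[ℝ] (X → ℝ) where
  toFun u := fun x => ws x * u (blk x)
  map_add' u u' := by
    funext x
    simp only [Pi.add_apply]
    ring
  map_smul' c u := by
    funext x
    simp only [Pi.smul_apply, smul_eq_mul, RingHom.id_apply]
    ring

/-- Unfolding equation of `injOp`. [folklore] -/
@[simp] theorem injOp_apply (blk : X → S) (ws : X → ℝ) (u : S → ℝ) (x : X) :
    injOp blk ws u x = ws x * u (blk x) := rfl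

/-- Block-locality of Q′\* — the hypothesis `hQs` of `B9Eq395Small.mulOp_comp_eq_of_local` DISCHARGED for `injOp`:
(Q′\*u)(x) = 0 whenever u vanishes at the block of x. [folklore] -/
theorem injOp_local (blk : X → S) (ws : X → ℝ) (u : S → ℝ) (x : X) (hu : u (blk x) = 0) :
    injOp blk ws u x = 0 := by
  rw [injOp_apply, hu, mul_zero]

end InjOp

section AvgOp

variable {X S : Type} [Fintype X] [DecidableEq S]

/-- The BLOCK-AVERAGING shape of (3.18)–(3.19) in the ℝ-scalar model (reading (a) of the header):
(Q′λ)(y) = Σ_{x : y(x) = y} w(x)λ(x), printed weight w(x) = L^{−jd}R(U(Γ^{(j)}_{y,x})) for x ∈ B^j(y), y ∈ Λ_j.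
[cite: Balaban1985BackgroundPropagators, (3.18)–(3.19) p.393] -/
def avgOp (blk : X → S) (w : X → ℝ) : (X → ℝ) →ₗ[ℝ] (S → ℝ) where
  toFun f := fun y => ∑ x, if blk x = y then w x * f x else 0
  map_add' f f' := by
    funext y
    simp only [Pi.add_apply]
    rw [← Finset.sum_add_distrib]
    refine Finset.sum_congr rfl fun x _ => ?_
    split_ifs <;> ring
  map_smul' c f := by
    funext y
    simp only [Pi.smul_apply, smul_eq_mul, RingHom.id_apply, Finset.mul_sum]
    refine Finset.sum_congr rfl fun x _ => ?_
    split_ifs <;> ring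

/-- Unfolding equation of `avgOp`. [folklore] -/
@[simp] theorem avgOp_apply (blk : X → S) (w : X → ℝ) (f : X → ℝ) (y : S) :
    avgOp blk w f y = ∑ x, if blk x = y then w x * f x else 0 := rfl

/-- Block-locality of Q′ — the hypothesis `hQ` of `B9Eq395Small.chi_comp_mulOp_eq_of_local` DISCHARGED for `avgOp`:
(Q′λ)(y) depends only on the restriction of λ to the block of y. [folklore] -/
theorem avgOp_local (blk : X → S) (w : X → ℝ) (f f' : X → ℝ) (y : S) (h : ∀ x, blk x = y → f x = f' x) :
    avgOp blk w f y = avgOp blk w f' y := by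
  simp only [avgOp_apply]
  refine Finset.sum_congr rfl fun x _ => ?_
  split_ifs with hx
  · rw [h x hx]
  · rfl

/-! ## §2  The weighted-adjoint identity, the (3.24) quadratic form, the (3.19) normalisation -/

variable [Fintype S]

/-- **Q′\* IS a block injection.**  For weighted ℓ² pairings Σ_x m(x)λ(x)λ′(x) on the fine lattice (print: m = η^d,
p. 393) and Σ_y n(y)u(y)u′(y) on 𝔅, the adjoint of the block averaging Q′ = `avgOp blk w` is the block injection
`injOp blk ws` with ws(x) = n(y(x))w(x)/m(x):  Σ_y n(y)u(y)(Q′λ)(y) = Σ_x m(x)(Q′\*u)(x)λ(x).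
[cite: Balaban1985BackgroundPropagators, (3.24)–(3.25) p.394] -/
theorem avgOp_adjoint (blk : X → S) (w m : X → ℝ) (n : S → ℝ) (hm : ∀ x, m x ≠ 0) (f : X → ℝ) (u : S → ℝ) :
    ∑ y, n y * u y * avgOp blk w f y = ∑ x, m x * injOp blk (fun x => n (blk x) * w x / m x) u x * f x := by
  simp only [avgOp_apply, injOp_apply, Finset.mul_sum]
  rw [Finset.sum_comm]
  refine Finset.sum_congr rfl fun x _ => ?_
  have hx := hm x
  simp only [mul_ite, mul_zero, Finset.sum_ite_eq, Finset.mem_univ, if_true]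
  field_simp

/-- **The shape of (3.24).**  With the adjoint weights of `avgOp_adjoint`, the quadratic form of Q′\*Q′ in the fine
pairing is Σ_y n(y)((Q′λ)(y))² — (3.24) is this with n(y) = a_j(L^jη)^{d−2} on Λ_j (the multiplication by a between
Q′\* and Q′ absorbed into n).  [cite: Balaban1985BackgroundPropagators, (3.24) p.394] -/
theorem quadForm_324 (blk : X → S) (w m : X → ℝ) (n : S → ℝ) (hm : ∀ x, m x ≠ 0) (f : X → ℝ) :
    ∑ x, m x * f x * injOp blk (fun x => n (blk x) * w x / m x) (avgOp blk w f) x =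
      ∑ y, n y * (avgOp blk w f y) ^ 2 := by
  have h := avgOp_adjoint blk w m n hm f (avgOp blk w f)
  rw [show (∑ y, n y * avgOp blk w f y ^ 2) = ∑ y, n y * avgOp blk w f y * avgOp blk w f y from
    Finset.sum_congr rfl fun y _ => by ring, h]
  exact Finset.sum_congr rfl fun x _ => by ring

omit [Fintype S] in
/-- **The (3.19) normalisation as a row-sum bound.**  If every weight satisfies |w(x)|·#{x′ : y(x′) = y(x)} ≤ c_Q
(print: |w| = L^{−jd}|R| ≤ L^{−jd} and #B^j(y) = L^{jd}, so c_Q = 1) then every block row sum Σ_{x : y(x) = y}|w(x)|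
is ≤ c_Q.  [cite: Balaban1985BackgroundPropagators, (3.19) p.393] -/
theorem fiber_abs_sum_le (blk : X → S) (w : X → ℝ) (cQ : ℝ) (hcQ : 0 ≤ cQ)
    (hw : ∀ x, |w x| * ((Finset.univ.filter fun x' => blk x' = blk x).card : ℝ) ≤ cQ) (y : S) :
    ∑ x, (if blk x = y then |w x| else 0) ≤ cQ := by
  rw [← Finset.sum_filter]
  set F := Finset.univ.filter (fun x => blk x = y) with hF
  by_cases hF0 : F.card = 0
  · rw [Finset.card_eq_zero] at hF0
    rw [hF0, Finset.sum_empty]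
    exact hcQ
  · have hpos : (0 : ℝ) < F.card := by exact_mod_cast Nat.pos_of_ne_zero hF0
    have hle : ∀ x ∈ F, |w x| ≤ cQ / F.card := by
      intro x hx
      have hbx : blk x = y := (Finset.mem_filter.mp hx).2
      have hFx : (Finset.univ.filter fun x' => blk x' = blk x) = F := by rw [hbx]
      have h1 := hw x
      rw [hFx] at h1
      rwa [le_div_iff₀ hpos]
    calc ∑ x ∈ F, |w x| ≤ ∑ x ∈ F, cQ / F.card := Finset.sum_le_sum hle
      _ = cQ := by
          rw [Finset.sum_const, nsmul_eq_mul]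
          field_simp

end AvgOp

/-! ## §3  Block-diagonal two-space majorants ([4] (2.51) shape, pv21's `HasMajorantHom`) for any `B6.Geometry` -/

section Majorants

variable {G : B6.Geometry} {X : Type} [DecidableEq G.Site]

/-- **Q′\* has the two-space majorant c_{Q\*}·1_{y=y′}** (from 𝔅, block map id, to the fine lattice, block map y(·)):
if |ws| ≤ c_{Q\*} then for u supported at y′ with |u| ≤ B, |(Q′\*u)(x)| ≤ c_{Q\*}1_{y(x)=y′}B.
[cite: Balaban1984PropagatorsII, (2.51) p.232; Balaban1985BackgroundPropagators, (3.25) p.394] -/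
theorem injOp_hasMajorantHom (blk : X → G.Site) (ws : X → ℝ) (cQs : ℝ) (hws : ∀ x, |ws x| ≤ cQs) :
    B6RandomWalkHom.HasMajorantHom (fun y : G.Site => y) blk (injOp blk ws)
      (fun a b => cQs * (if a = b then (1 : ℝ) else 0)) := by
  intro y' u B hu x
  dsimp only
  rw [injOp_apply, abs_mul]
  by_cases hx : blk x = y'
  · rw [if_pos hx, mul_one]
    exact mul_le_mul (hws x) (hu.bound (blk x) hx) (abs_nonneg _) ((abs_nonneg _).trans (hws x))
  · have h0 : u (blk x) = 0 := hu.off (blk x) hx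
    rw [h0, abs_zero, mul_zero, if_neg hx, mul_zero, zero_mul]

variable [Fintype X]

/-- **Q′ has the two-space majorant c_Q·1_{y=y′}** (from the fine lattice, block map y(·), to 𝔅, block map id): if every
block row sum Σ_{x : y(x)=y}|w(x)| is ≤ c_Q then for λ supported in B(y′) with |λ| ≤ B, |(Q′λ)(y)| ≤ c_Q1_{y=y′}B.
[cite: Balaban1984PropagatorsII, (2.51) p.232; Balaban1985BackgroundPropagators, (3.19) p.393] -/
theorem avgOp_hasMajorantHom (blk : X → G.Site) (w : X → ℝ) (cQ : ℝ)
    (hw : ∀ y, ∑ x, (if blk x = y then |w x| else 0) ≤ cQ) :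
    B6RandomWalkHom.HasMajorantHom blk (fun y : G.Site => y) (avgOp blk w)
      (fun a b => cQ * (if a = b then (1 : ℝ) else 0)) := by
  intro y' μ B hμ v
  dsimp only
  rw [avgOp_apply]
  by_cases hv : v = y'
  · rw [if_pos hv, mul_one]
    calc |∑ x, (if blk x = v then w x * μ x else 0)|
        ≤ ∑ x, |(if blk x = v then w x * μ x else 0)| := Finset.abs_sum_le_sum_abs _ _
      _ ≤ (∑ x, (if blk x = v then |w x| else 0)) * B := by
          rw [Finset.sum_mul]
          refine Finset.sum_le_sum fun x _ => ?_
          split_ifs with hx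
          · rw [abs_mul]
            exact mul_le_mul_of_nonneg_left (hμ.bound x (hx.trans hv)) (abs_nonneg _)
          · rw [abs_zero, zero_mul]
      _ ≤ cQ * B := mul_le_mul_of_nonneg_right (hw v) hμ.nonneg
  · have h0 : ∑ x, (if blk x = v then w x * μ x else 0) = 0 := by
      refine Finset.sum_eq_zero fun x _ => ?_
      split_ifs with hx
      · rw [hμ.off x (fun h => hv (hx.symm.trans h)), mul_zero]
      · rfl
    rw [h0, abs_zero, if_neg hv, mul_zero, zero_mul]

/-- `avgOp_hasMajorantHom` from the (3.19) normalisation in the form of `fiber_abs_sum_le`: |w(x)|·#B(y(x)) ≤ c_Q for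
every x (print: L^{−jd}·L^{jd} = 1) ⇒ Q′ ≺ c_Q·1_{y=y′}. [cite: Balaban1985BackgroundPropagators, (3.19) p.393] -/
theorem avgOp_hasMajorantHom_card (blk : X → G.Site) (w : X → ℝ) (cQ : ℝ) (hcQ : 0 ≤ cQ)
    (hw : ∀ x, |w x| * ((Finset.univ.filter fun x' => blk x' = blk x).card : ℝ) ≤ cQ) :
    B6RandomWalkHom.HasMajorantHom blk (fun y : G.Site => y) (avgOp blk w)
      (fun a b => cQ * (if a = b then (1 : ℝ) else 0)) :=
  avgOp_hasMajorantHom blk w cQ (fiber_abs_sum_le blk w cQ hcQ hw)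

end Majorants

/-! ## §4  The B9 geometry: the hypotheses hQ / hQs of `B9Eq395Hom` and h1 / h2 of `regroup_412` DISCHARGED -/

section B9

variable {g : B9.Geometry} [Fintype g.Site] [instDE : DecidableEq g.Site] {R : ℝ} {H : Prop} {X : Type}

/-- `injOp_hasMajorantHom` for the geometry `B9Thm34Ext.toB6 g R H` — literally the hypothesis `hQs` of
`B9Eq395Hom.sandwich_majorant` / `lloc_majorant` / `commFactor_hA`. [cite: Balaban1985BackgroundPropagators, (3.25) p.394] -/
theorem injOp_hasMajorantHom_b9 (blk : X → g.Site) (ws : X → ℝ) (cQs : ℝ) (hws : ∀ x, |ws x| ≤ cQs) :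
    B6RandomWalkHom.HasMajorantHom (g := B9Thm34Ext.toB6 g R H) (fun y : g.Site => y) blk (injOp blk ws)
      (fun (a b : g.Site) => cQs * (if a = b then (1 : ℝ) else 0)) :=
  @injOp_hasMajorantHom (B9Thm34Ext.toB6 g R H) X instDE blk ws cQs hws

omit [Fintype g.Site] in
/-- h2 of `B9Eq395Small.regroup_412` for Q′\* = `injOp`: h′Q′\*h_□ = Q′\*h_□ when h′ = 1 on the blocks of the sites of
S_χ and h_□ vanishes off S_χ (*"by the construction of the partition 𝒟′ we have h′_{□₀} = 1 on □̃"*, p. 412).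
[cite: Balaban1985BackgroundPropagators, p.412] -/
theorem regroup_h2_avg (blk : X → g.Site) (ws : X → ℝ) (Sχ : Finset g.Site) (h' : X → ℝ)
    (hh' : ∀ x, blk x ∈ Sχ → h' x = 1) (hc : g.Site → ℝ) (hhc : ∀ y, hc y ≠ 0 → y ∈ Sχ) :
    mulOp h' ∘ₗ injOp blk ws ∘ₗ mulOp hc = injOp blk ws ∘ₗ mulOp hc :=
  B9Eq395Small.mulOp_comp_eq_of_local blk (injOp blk ws) (fun u x hu => injOp_local blk ws u x hu) Sχ h' hh' hc hhc

variable [Fintype X]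

/-- `avgOp_hasMajorantHom` for the geometry `B9Thm34Ext.toB6 g R H` — literally the hypothesis `hQ` of
`B9Eq395Hom.sandwich_majorant` / `lloc_majorant` / `commFactor_hA`. [cite: Balaban1985BackgroundPropagators, (3.19) p.393] -/
theorem avgOp_hasMajorantHom_b9 (blk : X → g.Site) (w : X → ℝ) (cQ : ℝ)
    (hw : ∀ y : g.Site, ∑ x, (if blk x = y then |w x| else 0) ≤ cQ) :
    B6RandomWalkHom.HasMajorantHom (g := B9Thm34Ext.toB6 g R H) blk (fun y : g.Site => y) (avgOp blk w)
      (fun (a b : g.Site) => cQ * (if a = b then (1 : ℝ) else 0)) :=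
  @avgOp_hasMajorantHom (B9Thm34Ext.toB6 g R H) X instDE _ blk w cQ hw

omit [Fintype g.Site] in
/-- h1 of `B9Eq395Small.regroup_412` for Q′ = `avgOp`: □̃Q′h′ = □̃Q′ when h′ = 1 on the blocks of the sites of S_χ and
□̃ = χ vanishes off S_χ. [cite: Balaban1985BackgroundPropagators, p.412] -/
theorem regroup_h1_avg (blk : X → g.Site) (w : X → ℝ) (Sχ : Finset g.Site) (h' : X → ℝ)
    (hh' : ∀ x, blk x ∈ Sχ → h' x = 1) (χ : g.Site → ℝ) (hχ : ∀ y, y ∉ Sχ → χ y = 0) :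
    mulOp χ ∘ₗ avgOp blk w ∘ₗ mulOp h' = mulOp χ ∘ₗ avgOp blk w :=
  B9Eq395Small.chi_comp_mulOp_eq_of_local blk (avgOp blk w) (fun f f' y hf => avgOp_local blk w f f' y hf) Sχ h' hh'
    χ hχ

/-- `B9Eq395Hom.sandwich_majorant` with hQ / hQs DISCHARGED: Q′MQ′\* ≺ c_Qc_{Q\*}·K on 𝔅 for Q′ = `avgOp blk w` (row
sums ≤ c_Q), Q′\* = `injOp blk ws` (|ws| ≤ c_{Q\*}) and any M ≺ K ≥ 0 on the fine lattice.
[cite: Balaban1984PropagatorsII, (2.52)–(2.55) p.232] -/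
theorem sandwich_majorant_avg (blk : X → g.Site) (w ws : X → ℝ) (cQ cQs : ℝ) (hcQs : 0 ≤ cQs)
    (hw : ∀ y : g.Site, ∑ x, (if blk x = y then |w x| else 0) ≤ cQ) (hws : ∀ x, |ws x| ≤ cQs)
    {Mf : Module.End ℝ (X → ℝ)} {K : g.Site → g.Site → ℝ} (hK : ∀ a b, 0 ≤ K a b)
    (hM : B6RandomWalk.HasMajorant (g := B9Thm34Ext.toB6 g R H) blk Mf K) :
    B6RandomWalk.HasMajorant (g := B9Thm34Ext.toB6 g R H) (fun y : g.Site => y) (avgOp blk w ∘ₗ Mf ∘ₗ injOp blk ws)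
      (fun (a b : g.Site) => cQ * cQs * K a b) :=
  B9Eq395Hom.sandwich_majorant (R := R) (H := H) blk cQ cQs hcQs hK (avgOp_hasMajorantHom_b9 blk w cQ hw)
    (injOp_hasMajorantHom_b9 blk ws cQs hws) hM

/-- `B9Eq395Hom.lloc_majorant` with hQ / hQs DISCHARGED — the (3.95) third-sum operator L_□ = Q′G′_□G′_□Q′\* for
Q′ = `avgOp blk w`, Q′\* = `injOp blk ws`: L_□ ≺ κ_L(P y)⁻¹e^{−ρδ₀d(y,y″)}, κ_L = c_Qc_{Q\*}B_G²C·c₁(δ₀, a_G−ρ) — the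
hypothesis hL of `B9Eq395Small.thirdSum_term_majorant` / `B9Thm39Sum.firstSum_term_majorant`.
[cite: Balaban1985BackgroundPropagators, (3.95) p.411; Balaban1984PropagatorsII, (2.83) p.237] -/
theorem lloc_majorant_avg (blk : X → g.Site) (d : ℕ) (δ₀ aG αst ρ BG C cQ cQs : ℝ) (PG P : g.Site → ℝ)
    (w ws : X → ℝ)
    (hBG : 0 ≤ BG) (hC : 0 ≤ C) (hcQ : 0 ≤ cQ) (hcQs : 0 ≤ cQs) (hPG : ∀ y, 0 ≤ PG y) (hδ₀ : 0 ≤ δ₀)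
    (hρ : 0 ≤ ρ) (hsplit : αst + ρ ≤ aG)
    (htri : B6RandomWalk.Triangle254 (B9Thm34Ext.toB6 g R H)) (hsymm : ∀ a b : g.Site, g.dist a b = g.dist b a)
    (hdnn : ∀ a b : g.Site, 0 ≤ g.dist a b)
    (hST : B9Ineq347.ScaleTransfer g δ₀ αst C PG)
    (h261 : B6RandomWalk.Ineq261 d (B9Thm34Ext.toB6 g R H) δ₀ (aG - ρ))
    (hPP : ∀ y, PG y ^ 2 ≤ (P y)⁻¹)
    (hw : ∀ y : g.Site, ∑ x, (if blk x = y then |w x| else 0) ≤ cQ) (hws : ∀ x, |ws x| ≤ cQs)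
    {Gf : Module.End ℝ (X → ℝ)}
    (hG : B6RandomWalk.HasMajorant (g := B9Thm34Ext.toB6 g R H) blk Gf
      (fun (a b : g.Site) => BG * PG a * Real.exp (-(aG * δ₀ * g.dist a b)))) :
    B6RandomWalk.HasMajorant (g := B9Thm34Ext.toB6 g R H) (fun y : g.Site => y)
      (avgOp blk w ∘ₗ (Gf * Gf) ∘ₗ injOp blk ws)
      (fun (a y'' : g.Site) => (cQ * cQs * BG * BG * C * B6.c1 d δ₀ (aG - ρ)) * (P a)⁻¹ *
        Real.exp (-(ρ * δ₀ * g.dist a y''))) :=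
  B9Eq395Hom.lloc_majorant (R := R) (H := H) blk d δ₀ aG αst ρ BG C cQ cQs PG P hBG hC hcQ hcQs hPG hδ₀ hρ hsplit
    htri hsymm hdnn hST h261 hPP (avgOp_hasMajorantHom_b9 blk w cQ hw) (injOp_hasMajorantHom_b9 blk ws cQs hws) hG

/-- `B9Eq395Hom.commFactor_hA` with hQ / hQs DISCHARGED — the p. 412 commutator factor
A = Q′(G′_{□₀}h′² − h′²G′_{□₀})G′_{□₀}Q′\* for Q′ = `avgOp blk w`, Q′\* = `injOp blk ws`:
A ≺ θ_A(P y)⁻¹e^{−ρδ₀d(y,y″)}, θ_A = c_Qc_{Q\*}(2ℓ₀ + 2ℓ₁(α_cδ₀)⁻¹)B_G²C·c₁(δ₀, a_G−ρ) — the hypothesis hA of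
`B9Eq395Small.smallFactor_term_majorant` (*"The commutator in the first term gives O(M⁻¹)"*, p. 412).
[cite: Balaban1985BackgroundPropagators, p.412] -/
theorem commFactor_hA_avg (blk : X → g.Site) (d : ℕ) (δ₀ aG αc αst ρ ℓ₀ ℓ₁ BG C cQ cQs : ℝ) (PG P : g.Site → ℝ)
    (hp : X → ℝ) (w ws : X → ℝ)
    (hℓ₀ : 0 ≤ ℓ₀) (hℓ₁ : 0 ≤ ℓ₁) (hBG : 0 ≤ BG) (hC : 0 ≤ C) (hcQ : 0 ≤ cQ) (hcQs : 0 ≤ cQs)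
    (hPG : ∀ y, 0 ≤ PG y) (hδ₀ : 0 ≤ δ₀) (hαc : 0 < αc * δ₀) (hρ : 0 ≤ ρ) (hsplit : αst + αc + ρ ≤ aG)
    (htri : B6RandomWalk.Triangle254 (B9Thm34Ext.toB6 g R H)) (hsymm : ∀ a b : g.Site, g.dist a b = g.dist b a)
    (hdnn : ∀ a b : g.Site, 0 ≤ g.dist a b)
    (hST : B9Ineq347.ScaleTransfer g δ₀ αst C PG)
    (h261 : B6RandomWalk.Ineq261 d (B9Thm34Ext.toB6 g R H) δ₀ (aG - ρ))
    (hPP : ∀ y, PG y ^ 2 ≤ (P y)⁻¹)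
    (hh1 : ∀ x, |hp x| ≤ 1) (hLip : ∀ x x' : X, |hp x' - hp x| ≤ ℓ₀ + ℓ₁ * g.dist (blk x) (blk x'))
    (hw : ∀ y : g.Site, ∑ x, (if blk x = y then |w x| else 0) ≤ cQ) (hws : ∀ x, |ws x| ≤ cQs)
    {Gf : Module.End ℝ (X → ℝ)}
    (hG : B6RandomWalk.HasMajorant (g := B9Thm34Ext.toB6 g R H) blk Gf
      (fun (a b : g.Site) => BG * PG a * Real.exp (-(aG * δ₀ * g.dist a b)))) :
    B6RandomWalk.HasMajorant (g := B9Thm34Ext.toB6 g R H) (fun y : g.Site => y)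
      (avgOp blk w ∘ₗ ((Gf * (mulOp hp * mulOp hp) - (mulOp hp * mulOp hp) * Gf) * Gf) ∘ₗ injOp blk ws)
      (fun (a y'' : g.Site) => (cQ * cQs * (2 * ℓ₀ + 2 * ℓ₁ * (αc * δ₀)⁻¹) * BG * BG * C * B6.c1 d δ₀ (aG - ρ)) *
        (P a)⁻¹ * Real.exp (-(ρ * δ₀ * g.dist a y''))) :=
  B9Eq395Hom.commFactor_hA (R := R) (H := H) blk d δ₀ aG αc αst ρ ℓ₀ ℓ₁ BG C cQ cQs PG P hp hℓ₀ hℓ₁ hBG hC hcQ hcQs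
    hPG hδ₀ hαc hρ hsplit htri hsymm hdnn hST h261 hPP hh1 hLip (avgOp_hasMajorantHom_b9 blk w cQ hw)
    (injOp_hasMajorantHom_b9 blk ws cQs hws) hG

/-- `B9Eq395Hom.p412_commTerm_majorant` with hQ / hQs DISCHARGED — the first term of the p. 412 regrouping
□̃·Q′[G′_{□₀}, h′²]G′_{□₀}Q′\*·h_□C_□h_□ for Q′ = `avgOp blk w`, Q′\* = `injOp blk ws`, as ONE FACTOR of the random walk
expansion: ≺ 1_{S_□}(y′)·θ_AB₀C′c₁(δ₀, b−ρ′)·e^{−ρ′δ₀d(y,y′)} (*"The commutator in the first term gives O(M⁻¹). We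
consider this term as one factor in the random walk expansion"*, p. 412). [cite: Balaban1985BackgroundPropagators, p.412] -/
theorem p412_commTerm_majorant_avg (blk : X → g.Site) (d : ℕ) (δ₀ aG αc αst ρ ℓ₀ ℓ₁ BG C cQ cQs : ℝ)
    (PG : g.Site → ℝ) (hp : X → ℝ) (w ws : X → ℝ) (αst' ρ' b B₀ C' : ℝ) (P : g.Site → ℝ) (S : Finset g.Site)
    (χ h : g.Site → ℝ)
    (hℓ₀ : 0 ≤ ℓ₀) (hℓ₁ : 0 ≤ ℓ₁) (hBG : 0 ≤ BG) (hC : 0 ≤ C) (hcQ : 0 ≤ cQ) (hcQs : 0 ≤ cQs)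
    (hPG : ∀ y, 0 ≤ PG y) (hδ₀ : 0 ≤ δ₀) (hαc : 0 < αc * δ₀) (hρ : 0 ≤ ρ) (hsplit : αst + αc + ρ ≤ aG)
    (hB₀ : 0 ≤ B₀) (hC' : 0 ≤ C') (hP : ∀ y, 0 < P y) (hρ' : 0 ≤ ρ') (hsplit' : αst' + ρ' ≤ ρ)
    (htri : B6RandomWalk.Triangle254 (B9Thm34Ext.toB6 g R H)) (hsymm : ∀ a b : g.Site, g.dist a b = g.dist b a)
    (hdnn : ∀ a b : g.Site, 0 ≤ g.dist a b)
    (hST : B9Ineq347.ScaleTransfer g δ₀ αst C PG) (hST' : B9Ineq347.ScaleTransfer g δ₀ αst' C' P)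
    (h261 : B6RandomWalk.Ineq261 d (B9Thm34Ext.toB6 g R H) δ₀ (aG - ρ))
    (h261' : B6RandomWalk.Ineq261 d (B9Thm34Ext.toB6 g R H) δ₀ (b - ρ'))
    (hPP : ∀ y, PG y ^ 2 ≤ (P y)⁻¹)
    (hh1 : ∀ x, |hp x| ≤ 1) (hLip : ∀ x x' : X, |hp x' - hp x| ≤ ℓ₀ + ℓ₁ * g.dist (blk x) (blk x'))
    (hχ1 : ∀ y, |χ y| ≤ 1) (hh1' : ∀ y, |h y| ≤ 1) (hhS : ∀ y, h y ≠ 0 → y ∈ S)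
    (hw : ∀ y : g.Site, ∑ x, (if blk x = y then |w x| else 0) ≤ cQ) (hws : ∀ x, |ws x| ≤ cQs)
    {Gf : Module.End ℝ (X → ℝ)} {Cl : Module.End ℝ (g.Site → ℝ)}
    (hG : B6RandomWalk.HasMajorant (g := B9Thm34Ext.toB6 g R H) blk Gf
      (fun (a b : g.Site) => BG * PG a * Real.exp (-(aG * δ₀ * g.dist a b))))
    (hCl : B6RandomWalk.HasMajorant (g := B9Thm34Ext.toB6 g R H) (fun y : g.Site => y) Cl
      (fun (y'' b' : g.Site) => B₀ * P y'' * Real.exp (-(b * δ₀ * g.dist y'' b')))) :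
    B6RandomWalk.HasMajorant (g := B9Thm34Ext.toB6 g R H) (fun y : g.Site => y)
      (mulOp χ * (avgOp blk w ∘ₗ ((Gf * (mulOp hp * mulOp hp) - (mulOp hp * mulOp hp) * Gf) * Gf) ∘ₗ injOp blk ws) *
        (mulOp h * Cl * mulOp h))
      (fun (a b' : g.Site) => (if b' ∈ S then (1 : ℝ) else 0) *
        ((cQ * cQs * (2 * ℓ₀ + 2 * ℓ₁ * (αc * δ₀)⁻¹) * BG * BG * C * B6.c1 d δ₀ (aG - ρ)) * B₀ * C' *
          B6.c1 d δ₀ (b - ρ')) * Real.exp (-(ρ' * δ₀ * g.dist a b'))) :=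
  B9Eq395Hom.p412_commTerm_majorant (R := R) (H := H) blk d δ₀ aG αc αst ρ ℓ₀ ℓ₁ BG C cQ cQs PG hp αst' ρ' b B₀ C' P
    S χ h hℓ₀ hℓ₁ hBG hC hcQ hcQs hPG hδ₀ hαc hρ hsplit hB₀ hC' hP hρ' hsplit' htri hsymm hdnn hST hST' h261 h261' hPP
    hh1 hLip hχ1 hh1' hhS (avgOp_hasMajorantHom_b9 blk w cQ hw) (injOp_hasMajorantHom_b9 blk ws cQs hws) hG hCl

end B9

end Literature.MathematicalPhysics.QuantumFieldTheory.Balaban1983to89.B9Eq319Avg
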